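import Literature.Dynamics.Tilings.TorusCNFBandElim
import HarnessLib

/-!
# Torus CNFs whose band admits no tiling have short bounded-depth Frege refutations

Topic `Literature/Dynamics/Tilings`. Let `T` be a tile set with `t ≥ 1` tiles and `m < n`,
`n ≥ 2`. If the cyclic band `ℤ/n × {0, …, m}` admits NO tiling by `T` (`IsBandTiling`,
`BandTiling.lean`), then the torus CNF `torusCNF T n` has a LOCAL REFUTATION
(`IsLocalRefutation`, `DepthFregeLocalRefutation.lean`) of locality and width `3(m+1) + t` and
length `≤ (n+1)(m+1)(t+1) t^{3(m+1)}` (`exists_isLocalRefutation`), hence a depth-`17`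
`textbookFrege` proof of the torus tautology `torusForm T n` of size polynomial in `n` and
`t^(m+1)` (`exists_isDepthProofOf_torusForm`) — polynomial in `n` when `m = O(log n)`.

The refutation is dynamic programming over column states `σ : Fin (m+1) → Fin t`, written as
stages of local steps (`TorusCNFBandElim.lean`):
* phase `n - 1`: for every pair `(σ₀, σ)` of states of the columns `0` and `n - 1` with no valid
  completion (`Dead`), the clause `K = NS 0 σ₀ ++ NS (n-1) σ` contains a mismatch clause;
* phases `c = n - 2, …, 1`: for every dead pair `(σ₀, σ)` at column `c`, eliminate column `c + 1`
  (`isStaged_elimStages`): for every state `σ'` of column `c + 1` the clause `K ++ NS (c+1) σ'`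
  contains a mismatch clause or the phase-`(c+1)` clause of the dead pair `(σ₀, σ')`
  (`dead_succ`);
* phase `0`: for every `σ₀`, eliminate column `1` to derive `NS 0 σ₀` (no band tiling means every
  horizontally consistent `(σ₀, σ')` is dead at column `1`, `dead_one`);
* finally eliminate column `0` against the clauses `NS 0 σ₀` to derive the empty clause.

[folklore] (dynamic programming / bounded-width resolution on a cycle of bounded "pathwidth";
cf. Krajíček, *Proof complexity*, CUP 2019, §5.4).
-/

namespace Literature.Dynamics.Tilings

namespace TorusBand

open Literature.Computability.Complexity Literature.Computability.MetaComplexity WangTileSet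
open Literature.Computability.Complexity.PropForm (neg ofCNF)

universe v

variable {C : Type v} [DecidableEq C] {t n m : ℕ}

/-! ### Band assignments by columns, completions, dead pairs -/

/-- A band assignment given column by column is VALID: every column state is vertically
consistent and consecutive columns (cyclically) are horizontally consistent. [folklore] -/
def BandOK (T : WangTileSet (Fin t) C) (g : Fin n → Fin (m + 1) → Fin t) : Prop :=
  (∀ c, VC T (g c)) ∧ ∀ c : Fin n, HC T (g c) (g ⟨(c.1 + 1) % n, Nat.mod_lt _ c.pos⟩)

omit [DecidableEq C] in
/-- A valid band assignment by columns gives a band tiling. [folklore] -/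
theorem exists_isBandTiling_of_bandOK (T : WangTileSet (Fin t) C) (hmn : m < n)
    {g : Fin n → Fin (m + 1) → Fin t} (hg : BandOK T g) : ∃ g' : ℤ → ℕ → Fin t, T.IsBandTiling n m g' := by
  have hn : 0 < n := Nat.zero_lt_of_lt hmn
  refine ⟨fun c r => if h : r < m + 1 then g (colFin hn c) ⟨r, h⟩ else g (colFin hn c) ⟨0, Nat.succ_pos m⟩,
    fun c r => by simp only [colFin_add], fun c r hr => ?_, fun c r hr => ?_⟩
  · have hr' : r < m + 1 := Nat.lt_succ_of_le hr
    simp only [dif_pos hr', colFin_succ]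
    exact hg.2 (colFin hn c) ⟨r, hr'⟩
  · have hr0 : r < m + 1 := by omega
    have hr1 : r + 1 < m + 1 := by omega
    simp only [dif_pos hr0, dif_pos hr1]
    exact hg.1 (colFin hn c) ⟨r, hr0⟩ hr1

/-- A valid COMPLETION to the right of column `c`: states `g 0 = σ₀`, `g c = σ`, …, `g (n-1)`,
vertically consistent at `0` and from `c` on, horizontally consistent from `c` on and around the
corner `(n-1, 0)`. [folklore] -/
def Compl (T : WangTileSet (Fin t) C) (n c : ℕ) (σ₀ σ : Fin (m + 1) → Fin t)
    (g : ℕ → Fin (m + 1) → Fin t) : Prop :=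
  g 0 = σ₀ ∧ g c = σ ∧ VC T (g 0) ∧ (∀ c', c ≤ c' → c' < n → VC T (g c')) ∧
    (∀ c', c ≤ c' → c' + 1 < n → HC T (g c') (g (c' + 1))) ∧ HC T (g (n - 1)) (g 0)

/-- The pair `(σ₀, σ)` is DEAD at column `c`: no valid completion to the right. [folklore] -/
def Dead (T : WangTileSet (Fin t) C) (n c : ℕ) (σ₀ σ : Fin (m + 1) → Fin t) : Prop :=
  ¬ ∃ g, Compl T n c σ₀ σ g

omit [DecidableEq C] in
/-- **Dead pairs at the last column are locally inconsistent.** (`n ≥ 2`) [folklore] -/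
theorem not_consistent_of_dead_last (T : WangTileSet (Fin t) C) (hn : 2 ≤ n)
    {σ₀ σ : Fin (m + 1) → Fin t} (h : Dead T n (n - 1) σ₀ σ) :
    ¬ (VC T σ ∧ VC T σ₀ ∧ HC T σ σ₀) := by
  rintro ⟨h1, h2, h3⟩
  refine h ⟨fun c => if c = 0 then σ₀ else σ, by simp, by simp; omega, by simpa using h2, ?_, ?_, ?_⟩
  · intro c' hc' hc'n
    have : c' ≠ 0 := by omega
    simpa [this] using h1
  · intro c' hc' hc'n; omega
  · have h0 : n - 1 ≠ 0 := by omega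
    simpa [h0] using h3

omit [DecidableEq C] in
/-- **Dead pairs propagate**: if `(σ₀, σ)` is dead at `c` (`1 ≤ c`, `c + 1 < n`), `σ` and `σ₀`
are vertically consistent and `σ, σ'` horizontally consistent, then `(σ₀, σ')` is dead at `c + 1`.
[folklore] -/
theorem dead_succ (T : WangTileSet (Fin t) C) {c : ℕ} (hc : 1 ≤ c) (hcn : c + 1 < n)
    {σ₀ σ σ' : Fin (m + 1) → Fin t} (h : Dead T n c σ₀ σ) (hσ : VC T σ) (hσ₀ : VC T σ₀)
    (hσσ' : HC T σ σ') : Dead T n (c + 1) σ₀ σ' := by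
  rintro ⟨g, hg0, hgc, -, hvc, hhc, hwrap⟩
  refine h ⟨Function.update g c σ, ?_, Function.update_self _ _ _, ?_, ?_, ?_, ?_⟩
  · rw [Function.update_of_ne (by omega)]; exact hg0
  · rw [Function.update_of_ne (by omega), hg0]; exact hσ₀
  · intro c' hc' hc'n
    rcases Nat.eq_or_lt_of_le hc' with rfl | hlt
    · rw [Function.update_self]; exact hσ
    · rw [Function.update_of_ne (by omega)]; exact hvc c' hlt hc'n
  · intro c' hc' hc'n
    rcases Nat.eq_or_lt_of_le hc' with rfl | hlt
    · rw [Function.update_self, Function.update_of_ne (by omega), hgc]; exact hσσ'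
    · rw [Function.update_of_ne (by omega), Function.update_of_ne (by omega)]
      exact hhc c' hlt hc'n
  · rw [Function.update_of_ne (by omega), Function.update_of_ne (by omega)]; exact hwrap

omit [DecidableEq C] in
/-- **No band tiling: everything is dead at column `1`.** If no valid band assignment exists
(`n ≥ 2`), `σ₀` is vertically consistent and `σ₀, σ'` horizontally consistent, then `(σ₀, σ')`
is dead at column `1`. [folklore] -/
theorem dead_one (T : WangTileSet (Fin t) C) (hn : 2 ≤ n) (hno : ¬ ∃ g : Fin n → Fin (m + 1) → Fin t, BandOK T g)
    {σ₀ σ' : Fin (m + 1) → Fin t} (hσ₀ : VC T σ₀) (h01 : HC T σ₀ σ') : Dead T n 1 σ₀ σ' := by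
  rintro ⟨g, hg0, hg1, -, hvc, hhc, hwrap⟩
  refine hno ⟨fun c => g c.1, fun c => ?_, fun c => ?_⟩
  · show VC T (g c.1)
    rcases Nat.eq_zero_or_pos c.1 with h0 | hpos
    · rw [h0, hg0]; exact hσ₀
    · exact hvc c.1 hpos c.2
  · by_cases hlast : c.1 + 1 < n
    · have e : ((⟨(c.1 + 1) % n, Nat.mod_lt _ c.pos⟩ : Fin n) : ℕ) = c.1 + 1 := Nat.mod_eq_of_lt hlast
      show HC T (g c.1) (g ((⟨(c.1 + 1) % n, Nat.mod_lt _ c.pos⟩ : Fin n) : ℕ))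
      rw [e]
      rcases Nat.eq_zero_or_pos c.1 with h0 | hpos
      · rw [h0, hg0, zero_add, hg1]; exact h01
      · exact hhc c.1 hpos hlast
    · have hc : c.1 = n - 1 := by omega
      have e : ((⟨(c.1 + 1) % n, Nat.mod_lt _ c.pos⟩ : Fin n) : ℕ) = 0 := by
        simp only; rw [hc, Nat.sub_add_cancel (by omega), Nat.mod_self]
      show HC T (g c.1) (g ((⟨(c.1 + 1) % n, Nat.mod_lt _ c.pos⟩ : Fin n) : ℕ))
      rw [e, hc]; exact hwrap

/-! ### The clauses of the phases -/

/-- Column `0`. [folklore] -/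
def col0 (hmn : m < n) : Fin n := ⟨0, Nat.zero_lt_of_lt hmn⟩

/-- The DP clause of a pair: "column `0` is not in state `σ₀` or column `c` is not in state `σ`".
[folklore] -/
def K (hmn : m < n) (c : Fin n) (σ₀ σ : Fin (m + 1) → Fin t) : Clause ℕ :=
  NS hmn (col0 hmn) σ₀ ++ NS hmn c σ

open Classical in
/-- The dead pairs at column `c`, listed. [folklore] -/
noncomputable def deadPairs (T : WangTileSet (Fin t) C) (n m : ℕ) (c : ℕ) :
    List ((Fin (m + 1) → Fin t) × (Fin (m + 1) → Fin t)) :=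
  ((states m t) ×ˢ (states m t)).filter fun p => Dead T n c p.1 p.2

omit [DecidableEq C] in
/-- Membership in `deadPairs`. [folklore] -/
theorem mem_deadPairs {T : WangTileSet (Fin t) C} {c : ℕ} {p : (Fin (m + 1) → Fin t) × (Fin (m + 1) → Fin t)} :
    p ∈ deadPairs T n m c ↔ Dead T n c p.1 p.2 := by
  obtain ⟨σ₀, σ⟩ := p
  simp [deadPairs, mem_states]

omit [DecidableEq C] in
/-- There are at most `t^(m+1) · t^(m+1)` dead pairs. [folklore] -/
theorem length_deadPairs_le (T : WangTileSet (Fin t) C) (c : ℕ) :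
    (deadPairs T n m c).length ≤ t ^ (m + 1) * t ^ (m + 1) := by
  unfold deadPairs
  refine (List.length_filter_le _ _).trans ?_
  rw [List.length_product, length_states]

/-- **Weakening steps**: a clause containing a clause of `φ` or of the stock is a local step over
its own (at most `N`) variables. [folklore] -/
theorem isLocalStep_of_subset {φ : CNF ℕ} {N : ℕ} {pre : List (Clause ℕ)} {A B : Clause ℕ}
    (hA : A ∈ φ ∨ A ∈ pre) (hsub : ∀ l ∈ A, l ∈ B) (hN : B.length ≤ N) : IsLocalStep φ N pre B := by
  refine ⟨A, A, (B.map Prod.fst).dedup, hA, hA, List.nodup_dedup _,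
    (List.Sublist.length_le (List.dedup_sublist _)).trans (by simpa using hN), ?_, ?_, ?_,
    fun τ h _ => eval_of_subset hsub h⟩
  · intro l hl; rw [List.mem_dedup]; exact List.mem_map.2 ⟨l, hsub l hl, rfl⟩
  · intro l hl; rw [List.mem_dedup]; exact List.mem_map.2 ⟨l, hsub l hl, rfl⟩
  · intro l hl; rw [List.mem_dedup]; exact List.mem_map.2 ⟨l, hl, rfl⟩

section Phases

variable (T : WangTileSet (Fin t) C) (hmn : m < n)

/-- Phase `n - 1`: the DP clauses of the dead pairs at the last column (one stage). [folklore] -/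
noncomputable def topStage : List (Clause ℕ) :=
  (deadPairs T n m (n - 1)).map fun p => K hmn ⟨n - 1, by omega⟩ p.1 p.2

variable (t) in
/-- Phase `c` (`1 ≤ c`, `c + 1 < n`): for every dead pair at `c`, eliminate column `c + 1`;
empty for other `c`. [folklore] -/
noncomputable def midStages (c : ℕ) : List (List (Clause ℕ)) :=
  if h : 1 ≤ c ∧ c + 1 < n then
    (deadPairs T n m c).flatMap fun p => elimStages t hmn (K hmn ⟨c, by omega⟩ p.1 p.2) ⟨c + 1, h.2⟩
  else []

/-- The columns `i, i - 1, …, 1`. [folklore] -/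
def descFrom : ℕ → List ℕ
  | 0 => []
  | i + 1 => (i + 1) :: descFrom i

variable (t) in
/-- Phase `0` (`n ≥ 2`): for every `σ₀`, eliminate column `1` to derive `NS 0 σ₀`. [folklore] -/
noncomputable def phase0 (hn : 2 ≤ n) : List (List (Clause ℕ)) :=
  (states m t).flatMap fun σ₀ => elimStages t hmn (NS hmn (col0 hmn) σ₀) ⟨1, hn⟩

variable (t) in
/-- **All stages of the band refutation.** [folklore] -/
noncomputable def allStages (hn : 2 ≤ n) : List (List (Clause ℕ)) :=
  [topStage T hmn] ++ (descFrom (n - 2)).flatMap (midStages t T hmn) ++ phase0 t hmn hn ++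
    elimStages t hmn [] (col0 hmn)

/-! ### Stagedness of the phases -/

/-- The invariant: the DP clauses of all dead pairs at the columns `≥ c` are in the stock.
[folklore] -/
def Inv (c : ℕ) (pre : List (Clause ℕ)) : Prop :=
  ∀ c' : Fin n, c ≤ c'.1 → ∀ σ₀ σ : Fin (m + 1) → Fin t, Dead T n c'.1 σ₀ σ → K hmn c' σ₀ σ ∈ pre

variable {T hmn}

omit [DecidableEq C] in
/-- The invariant is monotone in the stock. [folklore] -/
theorem Inv.mono {c : ℕ} {pre pre' : List (Clause ℕ)} (h : Inv T hmn c pre) (hsub : ∀ C ∈ pre, C ∈ pre') :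
    Inv T hmn c pre' :=
  fun c' hc σ₀ σ hd => hsub _ (h c' hc σ₀ σ hd)

/-- **Phase `n - 1` is staged** over the empty stock and establishes the invariant at `n - 1`.
[folklore] -/
theorem isStaged_topStage (hn : 2 ≤ n) {N : ℕ} (hN : 3 * (m + 1) + t ≤ N) :
    IsStaged (T.torusCNF n) N [] [topStage T hmn] ∧ Inv T hmn (n - 1) (topStage T hmn) := by
  refine ⟨IsStaged.single fun A hA => ?_, fun c' hc' σ₀ σ hd => ?_⟩
  · obtain ⟨p, hp, rfl⟩ := List.mem_map.1 hA
    have hd := mem_deadPairs.1 hp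
    have hKN : (K hmn ⟨n - 1, by omega⟩ p.1 p.2).length ≤ N := by
      simp only [K, List.length_append, length_NS]; omega
    have hnc := not_consistent_of_dead_last T hn hd
    by_cases h1 : VC T p.2
    · by_cases h2 : VC T p.1
      · have h3 : ¬ HC T p.2 p.1 := fun h3 => hnc ⟨h1, h2, h3⟩
        obtain ⟨B, hB, hsub⟩ := exists_killer_of_not_hc T hmn (c := ⟨n - 1, by omega⟩)
          (c' := col0 hmn) (by simp only [col0]; rw [Nat.sub_add_cancel (by omega), Nat.mod_self]) h3
        refine isLocalStep_of_subset (Or.inl hB) (fun l hl => ?_) hKN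
        rcases List.mem_append.1 (hsub l hl) with h | h
        · exact List.mem_append_right _ h
        · exact List.mem_append_left _ h
      · obtain ⟨B, hB, hsub⟩ := exists_killer_of_not_vc T hmn (col0 hmn) h2
        exact isLocalStep_of_subset (Or.inl hB) (fun l hl => List.mem_append_left _ (hsub l hl)) hKN
    · obtain ⟨B, hB, hsub⟩ := exists_killer_of_not_vc T hmn ⟨n - 1, by omega⟩ h1
      exact isLocalStep_of_subset (Or.inl hB) (fun l hl => List.mem_append_right _ (hsub l hl)) hKN
  · obtain ⟨c', hc'lt⟩ := c'
    simp only at hc' hd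
    obtain rfl : c' = n - 1 := by omega
    exact List.mem_map.2 ⟨(σ₀, σ), mem_deadPairs.2 hd, rfl⟩

/-- **Availability for the middle phases**: with the invariant at `c + 1`, for a dead pair
`(σ₀, σ)` at `c` every `K c σ₀ σ ++ NS (c+1) σ'` contains an available clause. [folklore] -/
theorem avail_mid {c : ℕ} (hc : 1 ≤ c) (hcn : c + 1 < n) {pre : List (Clause ℕ)}
    (hinv : Inv T hmn (c + 1) pre) {σ₀ σ : Fin (m + 1) → Fin t} (hd : Dead T n c σ₀ σ)
    (σ' : Fin (m + 1) → Fin t) :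
    Avail (T.torusCNF n) pre (K hmn ⟨c, by omega⟩ σ₀ σ ++ NS hmn ⟨c + 1, hcn⟩ σ') := by
  by_cases h1 : VC T σ
  · by_cases h2 : VC T σ₀
    · by_cases h3 : HC T σ σ'
      · have hd' := dead_succ T hc hcn hd h1 h2 h3
        refine (Avail.of_mem_pre (hinv ⟨c + 1, hcn⟩ le_rfl σ₀ σ' hd')).of_subset fun l hl => ?_
        rcases List.mem_append.1 hl with h | h
        · exact List.mem_append_left _ (List.mem_append_left _ h)
        · exact List.mem_append_right _ h
      · obtain ⟨B, hB, hsub⟩ := exists_killer_of_not_hc T hmn (c := ⟨c, by omega⟩) (c' := ⟨c + 1, hcn⟩)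
          (by simp only; exact (Nat.mod_eq_of_lt hcn).symm) h3
        refine Avail.of_mem hB fun l hl => ?_
        rcases List.mem_append.1 (hsub l hl) with h | h
        · exact List.mem_append_left _ (List.mem_append_right _ h)
        · exact List.mem_append_right _ h
    · obtain ⟨B, hB, hsub⟩ := exists_killer_of_not_vc T hmn (col0 hmn) h2
      exact Avail.of_mem hB fun l hl => List.mem_append_left _ (List.mem_append_left _ (hsub l hl))
  · obtain ⟨B, hB, hsub⟩ := exists_killer_of_not_vc T hmn ⟨c, by omega⟩ h1
    exact Avail.of_mem hB fun l hl => List.mem_append_left _ (List.mem_append_right _ (hsub l hl))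

/-- **A middle phase is staged** and lowers the invariant by one column. [folklore] -/
theorem isStaged_midStages (ht : 0 < t) {c : ℕ} (hc : 1 ≤ c) (hcn : c + 1 < n) {N : ℕ}
    (hN : 3 * (m + 1) + t ≤ N) {pre : List (Clause ℕ)} (hinv : Inv T hmn (c + 1) pre) :
    IsStaged (T.torusCNF n) N pre (midStages t T hmn c) ∧
      Inv T hmn c (pre ++ (midStages t T hmn c).flatten) := by
  have hKlen : ∀ σ₀ σ : Fin (m + 1) → Fin t, (K hmn ⟨c, by omega⟩ σ₀ σ).length + (m + 1) + t ≤ N := by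
    intro σ₀ σ; simp only [K, List.length_append, length_NS]; omega
  -- over any list of dead pairs
  have key : ∀ L : List ((Fin (m + 1) → Fin t) × (Fin (m + 1) → Fin t)),
      (∀ p ∈ L, Dead T n c p.1 p.2) → ∀ pre' : List (Clause ℕ), Inv T hmn (c + 1) pre' →
      IsStaged (T.torusCNF n) N pre'
        (L.flatMap fun p => elimStages t hmn (K hmn ⟨c, by omega⟩ p.1 p.2) ⟨c + 1, hcn⟩) ∧
      ∀ p ∈ L, K hmn ⟨c, by omega⟩ p.1 p.2 ∈
        (L.flatMap fun p => elimStages t hmn (K hmn ⟨c, by omega⟩ p.1 p.2) ⟨c + 1, hcn⟩).flatten := by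
    intro L
    induction L with
    | nil => intro _ pre' _; simp [IsStaged]
    | cons p L ih =>
      intro hL pre' hinv'
      rw [List.flatMap_cons, IsStaged.append_iff]
      have h1 := isStaged_elimStages T hmn (K hmn ⟨c, by omega⟩ p.1 p.2) ⟨c + 1, hcn⟩ pre'
        (hKlen p.1 p.2) (avail_mid hc hcn hinv' (hL p List.mem_cons_self))
      obtain ⟨h2, h3⟩ := ih (fun q hq => hL q (List.mem_cons_of_mem _ hq)) _
        (hinv'.mono fun C hC => List.mem_append_left _ hC)
      refine ⟨⟨h1, h2⟩, fun q hq => ?_⟩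
      rw [List.flatten_append]
      rcases List.mem_cons.1 hq with rfl | hq
      · exact List.mem_append_left _ (mem_elimStages ht _ _)
      · exact List.mem_append_right _ (h3 q hq)
  have hmid : midStages t T hmn c =
      (deadPairs T n m c).flatMap fun p => elimStages t hmn (K hmn ⟨c, by omega⟩ p.1 p.2) ⟨c + 1, hcn⟩ := by
    simp [midStages, hc, hcn]
  obtain ⟨h1, h2⟩ := key (deadPairs T n m c) (fun p hp => mem_deadPairs.1 hp) pre hinv
  rw [hmid]
  refine ⟨h1, fun c' hc' σ₀ σ hd => ?_⟩
  rcases Nat.eq_or_lt_of_le hc' with he | hlt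
  · obtain ⟨c', hc'lt⟩ := c'
    simp only at he hd
    subst he
    exact List.mem_append_right _ (h2 (σ₀, σ) (mem_deadPairs.2 hd))
  · exact List.mem_append_left _ (hinv c' hlt σ₀ σ hd)

/-- **All middle phases are staged** and bring the invariant down to column `1`. [folklore] -/
theorem isStaged_allMid (ht : 0 < t) {N : ℕ} (hN : 3 * (m + 1) + t ≤ N) :
    ∀ i, i + 1 < n → ∀ pre : List (Clause ℕ), Inv T hmn (i + 1) pre →
      IsStaged (T.torusCNF n) N pre ((descFrom i).flatMap (midStages t T hmn)) ∧
        Inv T hmn 1 (pre ++ ((descFrom i).flatMap (midStages t T hmn)).flatten) := by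
  intro i
  induction i with
  | zero => intro _ pre hinv; simpa [descFrom, IsStaged] using hinv
  | succ i ih =>
    intro hin pre hinv
    rw [descFrom, List.flatMap_cons, IsStaged.append_iff]
    obtain ⟨h1, h2⟩ := isStaged_midStages ht (Nat.succ_pos i) hin hN hinv
    obtain ⟨h3, h4⟩ := ih (by omega) _ h2
    refine ⟨⟨h1, h3⟩, ?_⟩
    rw [List.flatten_append, ← List.append_assoc]
    exact h4

/-- **Phase `0` is staged** (given the invariant at `1` and no band assignment) and puts every
`NS 0 σ₀` in the stock. [folklore] -/
theorem isStaged_phase0 (ht : 0 < t) (hn : 2 ≤ n) (hno : ¬ ∃ g : Fin n → Fin (m + 1) → Fin t, BandOK T g)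
    {N : ℕ} (hN : 3 * (m + 1) + t ≤ N) {pre : List (Clause ℕ)} (hinv : Inv T hmn 1 pre) :
    IsStaged (T.torusCNF n) N pre (phase0 t hmn hn) ∧
      ∀ σ₀ : Fin (m + 1) → Fin t, NS hmn (col0 hmn) σ₀ ∈ (pre ++ (phase0 t hmn hn).flatten) := by
  have hKlen : ∀ σ₀ : Fin (m + 1) → Fin t, (NS hmn (col0 hmn) σ₀).length + (m + 1) + t ≤ N := by
    intro σ₀; simp only [length_NS]; omega
  have hav : ∀ pre' : List (Clause ℕ), Inv T hmn 1 pre' → ∀ σ₀ σ' : Fin (m + 1) → Fin t,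
      Avail (T.torusCNF n) pre' (NS hmn (col0 hmn) σ₀ ++ NS hmn ⟨1, hn⟩ σ') := by
    intro pre' hinv' σ₀ σ'
    by_cases h2 : VC T σ₀
    · by_cases h3 : HC T σ₀ σ'
      · exact Avail.of_mem_pre (hinv' ⟨1, hn⟩ le_rfl σ₀ σ' (dead_one T hn hno h2 h3))
      · obtain ⟨B, hB, hsub⟩ := exists_killer_of_not_hc T hmn (c := col0 hmn) (c' := ⟨1, hn⟩)
          (by simp only [col0]; exact (Nat.mod_eq_of_lt (by omega)).symm) h3
        exact Avail.of_mem hB hsub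
    · obtain ⟨B, hB, hsub⟩ := exists_killer_of_not_vc T hmn (col0 hmn) h2
      exact Avail.of_mem hB fun l hl => List.mem_append_left _ (hsub l hl)
  have key : ∀ L : List (Fin (m + 1) → Fin t), ∀ pre' : List (Clause ℕ), Inv T hmn 1 pre' →
      IsStaged (T.torusCNF n) N pre'
        (L.flatMap fun σ₀ => elimStages t hmn (NS hmn (col0 hmn) σ₀) ⟨1, hn⟩) ∧
      ∀ σ₀ ∈ L, NS hmn (col0 hmn) σ₀ ∈
        (L.flatMap fun σ₀ => elimStages t hmn (NS hmn (col0 hmn) σ₀) ⟨1, hn⟩).flatten := by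
    intro L
    induction L with
    | nil => intro pre' _; simp [IsStaged]
    | cons σ₀ L ih =>
      intro pre' hinv'
      rw [List.flatMap_cons, IsStaged.append_iff]
      have h1 := isStaged_elimStages T hmn (NS hmn (col0 hmn) σ₀) ⟨1, hn⟩ pre' (hKlen σ₀)
        (hav pre' hinv' σ₀)
      obtain ⟨h2, h3⟩ := ih _ (hinv'.mono fun C hC => List.mem_append_left _ hC)
      refine ⟨⟨h1, h2⟩, fun σ hσ => ?_⟩
      rw [List.flatten_append]
      rcases List.mem_cons.1 hσ with rfl | hσ
      · exact List.mem_append_left _ (mem_elimStages ht _ _)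
      · exact List.mem_append_right _ (h3 σ hσ)
  obtain ⟨h1, h2⟩ := key (states m t) pre hinv
  exact ⟨h1, fun σ₀ => List.mem_append_right _ (h2 σ₀ (mem_states σ₀))⟩

/-- **The final elimination is staged** once every `NS 0 σ₀` is in the stock, and derives `[]`.
[folklore] -/
theorem isStaged_final (ht : 0 < t) {N : ℕ} (hN : 3 * (m + 1) + t ≤ N) {pre : List (Clause ℕ)}
    (hpre : ∀ σ₀ : Fin (m + 1) → Fin t, NS hmn (col0 hmn) σ₀ ∈ pre) :
    IsStaged (T.torusCNF n) N pre (elimStages t hmn [] (col0 hmn)) ∧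
      ([] : Clause ℕ) ∈ (elimStages t hmn [] (col0 hmn)).flatten :=
  ⟨isStaged_elimStages T hmn [] (col0 hmn) pre (by simp; omega)
    fun σ => Avail.of_mem_pre (by simpa using hpre σ), mem_elimStages ht _ _⟩

/-- **All stages are staged** over the empty stock, and the empty clause is derived. [folklore] -/
theorem isStaged_allStages (ht : 0 < t) (hn : 2 ≤ n)
    (hno : ¬ ∃ g : Fin n → Fin (m + 1) → Fin t, BandOK T g) {N : ℕ} (hN : 3 * (m + 1) + t ≤ N) :
    IsStaged (T.torusCNF n) N [] (allStages t T hmn hn) ∧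
      ([] : Clause ℕ) ∈ (allStages t T hmn hn).flatten := by
  obtain ⟨s1, i1⟩ := isStaged_topStage (T := T) (hmn := hmn) hn hN
  have i1' : Inv T hmn (n - 2 + 1) ([] ++ [topStage T hmn].flatten) := by
    rw [show n - 2 + 1 = n - 1 by omega]; simpa using i1
  obtain ⟨s2, i2⟩ := isStaged_allMid (T := T) (hmn := hmn) ht hN (n - 2) (by omega) _ i1'
  obtain ⟨s3, i3⟩ := isStaged_phase0 ht hn hno hN i2
  obtain ⟨s4, m4⟩ := isStaged_final (T := T) (hmn := hmn) ht hN i3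
  refine ⟨?_, ?_⟩
  · rw [allStages, IsStaged.append_iff, IsStaged.append_iff, IsStaged.append_iff]
    refine ⟨⟨⟨s1, s2⟩, ?_⟩, ?_⟩
    · simpa [List.flatten_append] using s3
    · simpa [List.flatten_append, List.append_assoc] using s4
  · simp only [allStages, List.flatten_append, List.mem_append]
    exact Or.inr m4

/-! ### Sizes and the local refutation -/

/-- `descFrom i` has `i` members. [folklore] -/
theorem length_descFrom (i : ℕ) : (descFrom i).length = i := by
  induction i with
  | zero => rfl
  | succ i ih => simp [descFrom, ih]

omit [DecidableEq C] in
/-- Lengths of the clauses of all stages: at most `3(m+1) + t`. [folklore] -/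
theorem length_le_of_mem_allStages (hn : 2 ≤ n) {A : Clause ℕ} (hA : A ∈ (allStages t T hmn hn).flatten) :
    A.length ≤ 3 * (m + 1) + t := by
  simp only [allStages, List.flatten_append, List.mem_append, List.flatten_cons, List.flatten_nil,
    List.append_nil] at hA
  rcases hA with ((hA | hA) | hA) | hA
  · obtain ⟨p, -, rfl⟩ := List.mem_map.1 hA
    simp only [K, List.length_append, length_NS]; omega
  · rw [List.mem_flatten] at hA
    obtain ⟨S, hS, hAS⟩ := hA
    rw [List.mem_flatMap] at hS
    obtain ⟨c, -, hS⟩ := hS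
    unfold midStages at hS
    split_ifs at hS with h
    · rw [List.mem_flatMap] at hS
      obtain ⟨p, -, hS⟩ := hS
      have := length_le_of_mem_elimStages (List.mem_flatten.2 ⟨S, hS, hAS⟩)
      simp only [K, List.length_append, length_NS] at this; omega
    · simp at hS
  · rw [phase0, List.mem_flatten] at hA
    obtain ⟨S, hS, hAS⟩ := hA
    rw [List.mem_flatMap] at hS
    obtain ⟨σ₀, -, hS⟩ := hS
    have := length_le_of_mem_elimStages (List.mem_flatten.2 ⟨S, hS, hAS⟩)
    simp only [length_NS] at this; omega
  · have := length_le_of_mem_elimStages hA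
    simp at this; omega

omit [DecidableEq C] in
/-- The number of clauses of all stages: at most `(n+1)(m+1)(t+1)t^{3(m+1)}`. [folklore] -/
theorem length_flatten_allStages (hn : 2 ≤ n) :
    (allStages t T hmn hn).flatten.length ≤ (n + 1) * ((m + 1) * ((t + 1) * t ^ (3 * (m + 1)))) := by
  set E := (m + 1) * ((t + 1) * t ^ (m + 1)) with hE
  set P := t ^ (m + 1) * t ^ (m + 1) with hP
  have hpow : P * t ^ (m + 1) = t ^ (3 * (m + 1)) := by
    rw [hP, ← pow_add, ← pow_add]; congr 1; ring
  have hE1 : ∀ Kp d, (elimStages t hmn Kp d).flatten.length ≤ E := fun Kp d => length_flatten_elimStages hmn Kp d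
  -- top
  have h1 : (topStage T hmn).length ≤ P := by
    rw [topStage, List.length_map]; exact length_deadPairs_le T _
  -- middle
  have h2 : ((descFrom (n - 2)).flatMap (midStages t T hmn)).flatten.length ≤ (n - 2) * (P * E) := by
    refine (length_flatten_flatMap_le _ _ (P * E) fun c _ => ?_).trans (by rw [length_descFrom])
    unfold midStages
    split_ifs with h
    · refine (length_flatten_flatMap_le _ _ E fun p _ => hE1 _ _).trans ?_
      exact Nat.mul_le_mul_right _ (length_deadPairs_le T _)
    · simp
  -- phase 0
  have h3 : (phase0 t hmn hn).flatten.length ≤ t ^ (m + 1) * E := by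
    unfold phase0
    refine (length_flatten_flatMap_le _ _ E fun σ₀ _ => hE1 _ _).trans ?_
    rw [length_states]
  have h4 := hE1 [] (col0 hmn)
  have htot : (allStages t T hmn hn).flatten.length ≤ P + (n - 2) * (P * E) + t ^ (m + 1) * E + E := by
    simp only [allStages, List.flatten_append, List.length_append, List.flatten_cons, List.flatten_nil,
      List.append_nil]
    omega
  refine htot.trans ?_
  have hE' : P * E = (m + 1) * ((t + 1) * t ^ (3 * (m + 1))) := by
    rw [← hpow, hE]; ring
  rw [← hE']
  set X := P * E with hX
  rcases Nat.eq_zero_or_pos t with ht0 | htpos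
  · subst ht0
    have hP0 : P = 0 := by simp [hP]
    have hE0 : E = 0 := by simp [hE]
    have hX0 : X = 0 := by simp [hX, hP0]
    simp [hP0, hE0, hX0]
  · have hPpos : 0 < P := by rw [hP]; positivity
    have hEpos : 0 < E := by rw [hE]; positivity
    have a1 : P ≤ X := Nat.le_mul_of_pos_right _ hEpos
    have a2 : E ≤ X := Nat.le_mul_of_pos_left _ hPpos
    have a3 : t ^ (m + 1) * E ≤ X := by
      rw [hX, hP]
      exact Nat.mul_le_mul_right _ (Nat.le_mul_of_pos_right _ (by positivity))
    calc P + (n - 2) * X + t ^ (m + 1) * E + E ≤ X + (n - 2) * X + X + X :=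
          Nat.add_le_add (Nat.add_le_add (Nat.add_le_add a1 le_rfl) a3) a2
      _ = (n - 2 + 3) * X := by ring
      _ ≤ (n + 1) * X := Nat.mul_le_mul_right _ (by omega)

/-- **The local refutation of the torus CNF from an untileable band.** If `t ≥ 1`, `2 ≤ n`,
`m < n` and the cyclic band `ℤ/n × {0, …, m}` admits no tiling by `T`, then `torusCNF T n` has a
local refutation of locality and width `3(m+1) + t` with at most `(n+1)(m+1)(t+1)t^{3(m+1)}`
clauses. [folklore] -/
theorem exists_isLocalRefutation (T : WangTileSet (Fin t) C) (ht : 0 < t) (hn : 2 ≤ n) (hmn : m < n)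
    (hno : ¬ ∃ g : ℤ → ℕ → Fin t, T.IsBandTiling n m g) :
    ∃ cs, IsLocalRefutation (T.torusCNF n) (3 * (m + 1) + t) (3 * (m + 1) + t) cs ∧
      cs.length ≤ (n + 1) * ((m + 1) * ((t + 1) * t ^ (3 * (m + 1)))) := by
  have hno' : ¬ ∃ g : Fin n → Fin (m + 1) → Fin t, BandOK T g :=
    fun ⟨g, hg⟩ => hno (exists_isBandTiling_of_bandOK T hmn hg)
  obtain ⟨hst, hnil⟩ := isStaged_allStages (T := T) (hmn := hmn) ht hn hno' le_rfl
  refine ⟨(allStages t T hmn hn).flatten, IsLocalRefutation.of_isStaged hst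
    (fun A hA => length_le_of_mem_allStages hn hA) (fun A hA => ?_) hnil,
    length_flatten_allStages hn⟩
  rcases (mem_torusCNF_iff T n A).1 hA with
    ⟨i, j, rfl⟩ | ⟨i, j, s, s', -, rfl⟩ | ⟨i, j, s, s', -, rfl⟩ | ⟨i, j, s, s', -, rfl⟩
  · simp
  all_goals simp; omega

end Phases

/-- **Short bounded-depth Frege proofs of torus tautologies from an untileable band.** If
`t ≥ 1`, `2 ≤ n`, `m < n` and the cyclic band `ℤ/n × {0, …, m}` admits no tiling by `T`, then
the torus tautology `torusForm T n` has a depth-`17` `textbookFrege` proof of size at most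
`2^(3(m+1)+t+27) · (|torusCNF T n| + (n+1)(m+1)(t+1)t^{3(m+1)} + 6(m+1) + 2t + 2)^6`. [folklore] -/
theorem exists_isDepthProofOf_torusForm (T : WangTileSet (Fin t) C) (ht : 0 < t) (hn : 2 ≤ n)
    (hmn : m < n) (hno : ¬ ∃ g : ℤ → ℕ → Fin t, T.IsBandTiling n m g) :
    ∃ π, textbookFrege.IsDepthProofOf 17 π (T.torusForm n) ∧
      proofSize π ≤ 2 ^ (3 * (m + 1) + t + 27) *
        ((T.torusCNF n).length + (n + 1) * ((m + 1) * ((t + 1) * t ^ (3 * (m + 1)))) +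
          (3 * (m + 1) + t) + (3 * (m + 1) + t) + 2) ^ 6 := by
  obtain ⟨cs, hcs, hlen⟩ := exists_isLocalRefutation T ht hn hmn hno
  obtain ⟨π, hπ, hsize⟩ := hcs.exists_isDepthProofOf
  refine ⟨π, hπ, hsize.trans (Nat.mul_le_mul_left _ (Nat.pow_le_pow_left ?_ 6))⟩
  omega

end TorusBand

end Literature.Dynamics.Tilings
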